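import Summits.BirchSwinnertonDyer.BirchSwinnertonDyer.Theorems.CyclotomicUntwistNineIntegersLocalRing
import Literature.NumberTheory.EllipticCurves.MinimalModelReduction
import Literature.NumberTheory.EllipticCurves.GlobalMinimalModelProofs
import Summits.BirchSwinnertonDyer.BirchSwinnertonDyer.Theorems.CyclotomicUntwistGNineNineGoodModelOfPSRow
import HarnessLib

/-!
# Good models over `𝓞 = integralClosure ℤ₃ ℚ₃(ζ₉)` are UNIQUE up to an `𝓞`-integral change of variables; the
# special fibre of a `NineGoodModel` is ONE curve over `𝔽₃` up to isomorphism, `specialFibreTrace` is an invariant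
# of the curve, and on every principal-series row EVERY good model has trace `a_w(W)` — without the existence fact

Cell `pub/bsd-wall` (D-0145 line `route-BirchSwinnertonDyer-CyclotomicUntwist`), seat `bsd-line-cycu-p4` (gen 7),
helper toward K1 `PSRankOneLowerHalfAtThree` (stmt-BirchSwinnertonDyer-21580) / K2 (21581); line `dfrob`, stub S2 =
second conjunct of item C2 `PSDescendedFrobeniusPrintedInputsAtThree` (stmt-27549). Sequel of the `NineIntegers*`
files (ρ exists and is unique; `𝓞` is a DVR with uniformizer `1 − ζ₉`). THEOREMS ONLY (no definition, no instance,
no named fact, no `sorry`); BSD is not proved by this file and no crux is.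

## What and why

The Literature predicate `IsDescendedFrobeniusMatrix W M` (p623342) quantifies over ALL good models
`𝓜 : W.NineGoodModel`, and its named existence fact `isDescendedFrobeniusMatrix_exists` takes the SUPERSINGULARITY
hypothesis `3 ∣ 𝓜.specialFibreTrace ρ` for the model at hand; cycu-p3's (B1) (`exists_nineGoodModel_specialFibreTrace_
of_psRow`, p627422) produced ONE explicit good model with trace `a_w(W) = psUntwistedTrace W`, and the Literature
docstring asserts (without proof) that "all good models have the same special-fibre trace" as a CONSEQUENCE of the
named fact (`trace_eq`). Since `𝓞` is now a discrete valuation ring with fraction field `K`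
(`NineIntegers.isDiscreteValuationRing`, `isFractionRing`), Silverman VII.1.3(b) — in the tree for any DVR as
`WeierstrassCurve.exists_variableChange_baseChange_eq_of_isMinimal` (Literature `MinimalModelReduction`) — applies to
`𝓞` verbatim and gives, WITHOUT any named fact:

* §14 `isFractionRing : IsFractionRing ONine KNine`, `isIntegral_curve`, `valuation_Δ_curve` (the equation of a
  good model is an integral MINIMAL Weierstrass equation over `𝓞`: unit discriminant);
* §15 **`exists_variableChange_smul_eq`**: two good models `𝓜₁, 𝓜₂` of the same elliptic `W/ℚ` satisfy
  `D • 𝓜₁.E = 𝓜₂.E` for a change of variables `D` OVER `𝓞` with `D ⊗ K = 𝓜₂.C·𝓜₁.C⁻¹`;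
* §16 **`exists_variableChange_specialFibre`** (the special fibres differ by `D mod (1 − ζ₉)`, a change of variables
  over `𝔽₃`), **`specialFibreTrace_eq_of_nineGoodModel`** (same trace for all good models and — by
  `residueMap_unique` — all reduction maps: `…_of_residueMap`);
* §17 `specialFibreTrace_eq_of_variableChange` (invariance under `ℚ`-isomorphism `W ↦ C₀ • W`),
  **`specialFibreTrace_eq_psUntwistedTrace_of_psRow`** (on a PS row EVERY good model has trace `a_w(W)`),
  **`three_dvd_specialFibreTrace_of_psRow`** (every good model of a PS row is supersingular — the hypothesis of the
  named fact holds for ANY model), and `trace_eq_psUntwistedTrace_of_psRow` (under the existence fact, `tr M = a_w`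
  read from any model / any `ρ`).

References: J. H. Silverman, *AEC*, Prop. VII.1.3(b) (p. 186), VII.2 [SilvermanAEC2009]; A. Kraus, Manuscripta Math.
69 (1990), Théorème (p = 3) [Kraus1990]; P. Berthelot, A. Ogus, Invent. Math. 72 (1983) (3.14) [BerthelotOgus1983].
-/

noncomputable section

open scoped Polynomial

open Polynomial IsCyclotomicExtension WeierstrassCurve Literature.NumberTheory.EllipticCurves.DescendedFrobenius
  Summit.BirchSwinnertonDyer.BirchSwinnertonDyer.Theorems

-- single-conjunct summit: `Summit.BirchSwinnertonDyer.BirchSwinnertonDyer.…` repeats the name by design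
set_option linter.dupNamespace false
set_option autoImplicit false

namespace Summit.BirchSwinnertonDyer.BirchSwinnertonDyer.Theorems.NineIntegers

/-! ### §14 `K = Frac 𝓞`; good models are minimal Weierstrass equations over the DVR `𝓞` -/

/-- `ℚ₃(ζ₉)` is the fraction field of `𝓞`. [folklore] -/
theorem isFractionRing : IsFractionRing ONine KNine := by
  haveI : FiniteDimensional ℚ_[3] KNine := IsCyclotomicExtension.finite {9} ℚ_[3] KNine
  exact IsIntegralClosure.isFractionRing_of_finite_extension ℤ_[3] ℚ_[3] KNine ONine

/-- The equation of a good model, read in `K`, is `𝓞`-integral. [folklore] -/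
theorem isIntegral_curve {W : WeierstrassCurve ℚ} (𝓜 : W.NineGoodModel) :
    WeierstrassCurve.IsIntegral ONine 𝓜.curve :=
  ⟨⟨𝓜.E, rfl⟩⟩

/-- The discriminant of a good model has valuation `1` at the maximal ideal of the DVR `𝓞`. [folklore] -/
theorem valuation_Δ_curve {W : WeierstrassCurve ℚ} (𝓜 : W.NineGoodModel) :
    haveI := isDiscreteValuationRing
    haveI := isFractionRing
    IsDedekindDomain.HeightOneSpectrum.valuation KNine (IsDiscreteValuationRing.maximalIdeal ONine) 𝓜.curve.Δ = 1 := by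
  haveI := isDiscreteValuationRing
  haveI := isFractionRing
  have e : 𝓜.curve.Δ = algebraMap ONine KNine 𝓜.E.Δ := by
    rw [NineGoodModel.curve, map_Δ]
  rw [e]
  obtain ⟨u, hu⟩ := 𝓜.isUnit_Δ
  rw [← hu]
  set v := IsDiscreteValuationRing.maximalIdeal ONine
  have h1 := v.valuation_le_one (K := KNine) (u : ONine)
  have h12 : v.valuation KNine (algebraMap ONine KNine (u : ONine)) *
      v.valuation KNine (algebraMap ONine KNine ((u⁻¹ : ONineˣ) : ONine)) = 1 := by
    rw [← map_mul, ← map_mul, Units.mul_inv, map_one, map_one]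
  refine le_antisymm h1 ?_
  calc (1 : WithZero (Multiplicative ℤ)) = _ := h12.symm
    _ ≤ v.valuation KNine (algebraMap ONine KNine (u : ONine)) * 1 := by
        gcongr; exact v.valuation_le_one (K := KNine) _
    _ = _ := mul_one _

/-! ### §15 Two good models differ by an `𝓞`-integral change of variables -/

/-- **Uniqueness of good models up to `𝓞`-isomorphism** (Silverman VII.1.3(b) over the DVR `𝓞`; the equations of
good models are MINIMAL Weierstrass equations since their discriminants are units): for two good models `𝓜₁, 𝓜₂`
of the same elliptic `W/ℚ` there is a change of variables `D` over `𝓞` with `D • 𝓜₁.E = 𝓜₂.E` and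
`D ⊗ K = 𝓜₂.C · 𝓜₁.C⁻¹`. [cite: SilvermanAEC2009, Prop. VII.1.3(b), p. 186] -/
theorem exists_variableChange_smul_eq {W : WeierstrassCurve ℚ} [W.IsElliptic] (𝓜₁ 𝓜₂ : W.NineGoodModel) :
    ∃ D : VariableChange ONine, D • 𝓜₁.E = 𝓜₂.E ∧ D.baseChange KNine = 𝓜₂.C * 𝓜₁.C⁻¹ := by
  haveI := isDiscreteValuationRing
  haveI := isFractionRing
  haveI := isIntegral_curve 𝓜₁
  haveI := isIntegral_curve 𝓜₂
  haveI : WeierstrassCurve.IsMinimal ONine 𝓜₁.curve := isMinimal_of_valuation_Δ_eq_one _ (valuation_Δ_curve 𝓜₁)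
  have hmin₂ : WeierstrassCurve.IsMinimal ONine 𝓜₂.curve := isMinimal_of_valuation_Δ_eq_one _ (valuation_Δ_curve 𝓜₂)
  have h12 : (𝓜₂.C * 𝓜₁.C⁻¹) • 𝓜₁.curve = 𝓜₂.curve := by
    rw [NineGoodModel.curve, NineGoodModel.curve, ← 𝓜₁.smul_eq, ← 𝓜₂.smul_eq, smul_smul, mul_assoc,
      inv_mul_cancel, mul_one]
  haveI : WeierstrassCurve.IsMinimal ONine ((𝓜₂.C * 𝓜₁.C⁻¹) • 𝓜₁.curve) := by rw [h12]; exact hmin₂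
  have hΔ : 𝓜₁.curve.Δ ≠ 0 := by
    have e : 𝓜₁.curve = 𝓜₁.C • W.map (algebraMap ℚ KNine) := by rw [NineGoodModel.curve, 𝓜₁.smul_eq]
    rw [e, variableChange_Δ, map_Δ]
    exact mul_ne_zero (pow_ne_zero _ (Units.ne_zero _))
      ((_root_.map_ne_zero (algebraMap ℚ KNine)).mpr W.isUnit_Δ.ne_zero)
  obtain ⟨D, hD⟩ := exists_variableChange_baseChange_eq_of_isMinimal (R := ONine) 𝓜₁.curve (𝓜₂.C * 𝓜₁.C⁻¹) hΔ
  refine ⟨D, ?_, hD⟩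
  apply WeierstrassCurve.map_injective (IsFractionRing.injective ONine KNine)
  have e : (D • 𝓜₁.E).map (algebraMap ONine KNine) = D.baseChange KNine • 𝓜₁.curve := by
    rw [NineGoodModel.curve, VariableChange.baseChange, ← map_variableChange]
  show (D • 𝓜₁.E).map (algebraMap ONine KNine) = 𝓜₂.E.map (algebraMap ONine KNine)
  rw [e, hD, h12, NineGoodModel.curve]

/-! ### §16 The special fibre is well defined: same curve over `𝔽₃` up to an admissible change of variables -/

/-- **The special fibres of two good models differ by a change of variables over `𝔽₃`** (the reduction of the
`𝓞`-integral `D` of `exists_variableChange_smul_eq`). [cite: SilvermanAEC2009, VII.2 (remark before Prop. 2.1)] -/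
theorem exists_variableChange_specialFibre {W : WeierstrassCurve ℚ} [W.IsElliptic] (𝓜₁ 𝓜₂ : W.NineGoodModel)
    (ρ : ONine →+* ZMod 3) :
    ∃ D : VariableChange (ZMod 3), D • 𝓜₁.specialFibre ρ = 𝓜₂.specialFibre ρ := by
  obtain ⟨D, hD, -⟩ := exists_variableChange_smul_eq 𝓜₁ 𝓜₂
  refine ⟨D.map ρ, ?_⟩
  rw [NineGoodModel.specialFibre, NineGoodModel.specialFibre, ← hD, map_variableChange]

/-- **`specialFibreTrace` is an invariant of the curve**: any two good models of `W` over `𝓞` have the same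
special-fibre point count and trace along every reduction map — model-independence of the D5 datum `tr φ` WITHOUT
the existence fact `isDescendedFrobeniusMatrix_exists` (whose `trace_eq` gave it only a posteriori).
[cite: SilvermanAEC2009, Prop. VII.1.3(b) and VII.2] -/
theorem specialFibreTrace_eq_of_nineGoodModel {W : WeierstrassCurve ℚ} [W.IsElliptic] (𝓜₁ 𝓜₂ : W.NineGoodModel)
    (ρ : ONine →+* ZMod 3) : 𝓜₁.specialFibreTrace ρ = 𝓜₂.specialFibreTrace ρ := by
  obtain ⟨D, hD⟩ := exists_variableChange_specialFibre 𝓜₁ 𝓜₂ ρ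
  rw [NineGoodModel.specialFibreTrace, NineGoodModel.specialFibreTrace, ← hD, natCard_point_smul]

/-- The special fibre and its trace do not depend on the reduction map either (`residueMap_unique`): the pair
(`W`, `𝓞 →+* 𝔽₃`) determines ONE point count. [folklore] -/
theorem specialFibreTrace_eq_of_nineGoodModel_of_residueMap {W : WeierstrassCurve ℚ} [W.IsElliptic]
    (𝓜₁ 𝓜₂ : W.NineGoodModel) (ρ₁ ρ₂ : ONine →+* ZMod 3) :
    𝓜₁.specialFibreTrace ρ₁ = 𝓜₂.specialFibreTrace ρ₂ := by
  rw [residueMap_unique ρ₁ ρ₂, specialFibreTrace_eq_of_nineGoodModel 𝓜₁ 𝓜₂ ρ₂]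


/-! ### §17 Consequences: invariance under `ℚ`-isomorphism, and EVERY good model of a principal-series row -/

/-- Good models of `ℚ`-isomorphic equations have the same special-fibre count: for `𝓜` a good model of `W` and `𝓜'`
one of `C₀ • W`, `𝓜.specialFibreTrace ρ = 𝓜'.specialFibreTrace ρ'`. [cite: SilvermanAEC2009, VII.1.3] -/
theorem specialFibreTrace_eq_of_variableChange {W : WeierstrassCurve ℚ} [W.IsElliptic] (C₀ : VariableChange ℚ)
    (𝓜 : W.NineGoodModel) (𝓜' : (C₀ • W).NineGoodModel) (ρ ρ' : ONine →+* ZMod 3) :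
    𝓜.specialFibreTrace ρ = 𝓜'.specialFibreTrace ρ' := by
  have e : 𝓜.specialFibreTrace ρ = (𝓜.ofVariableChange C₀).specialFibreTrace ρ := rfl
  rw [e]
  exact specialFibreTrace_eq_of_nineGoodModel_of_residueMap _ _ ρ ρ'

/-- **On a principal-series row EVERY good model has special-fibre trace `a_w(W)`** (cycu-p3's explicit model
`exists_nineGoodModel_specialFibreTrace_of_psRow` has it; all good models agree): for `W/ℚ` elliptic, globally
minimal, `ClassO6 W 3`, `v₃Δ_min` even, `Δ_min/3^v ≡ 1 (mod 3)`, every `𝓜 : W.NineGoodModel` and every `ρ` give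
`𝓜.specialFibreTrace ρ = W.psUntwistedTrace`. [cite: Kraus1990, Théorème (p = 3)] [cite: SilvermanAEC2009, Prop. VII.1.3(b)] -/
theorem specialFibreTrace_eq_psUntwistedTrace_of_psRow (W : WeierstrassCurve ℚ) [W.IsElliptic]
    [W.IsGloballyMinimal] (hO6 : Summit.BirchSwinnertonDyer.Rank1Residual.Additive.ClassO6 W 3)
    (hev : Even (padicValInt 3 W.minimalDiscriminantInt))
    (hsq : W.minimalDiscriminantInt / 3 ^ padicValInt 3 W.minimalDiscriminantInt % 3 = 1)
    (𝓜 : W.NineGoodModel) (ρ : ONine →+* ZMod 3) : 𝓜.specialFibreTrace ρ = W.psUntwistedTrace := by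
  obtain ⟨𝓜₀, h𝓜₀⟩ := GNineFrobeniusTrace.exists_nineGoodModel_specialFibreTrace_of_psRow W hO6 hev hsq
  rw [specialFibreTrace_eq_of_nineGoodModel 𝓜 𝓜₀ ρ, h𝓜₀ ρ]

/-- Hence **every good model of a principal-series row is supersingular**: `3 ∣ 𝓜.specialFibreTrace ρ` and
`|𝓜.specialFibreTrace ρ| ≤ 3` — the hypothesis of the named fact `isDescendedFrobeniusMatrix_exists` holds for
ANY good model, not only for the explicit one. [cite: Kraus1990, Théorème (p = 3)] -/
theorem three_dvd_specialFibreTrace_of_psRow (W : WeierstrassCurve ℚ) [W.IsElliptic] [W.IsGloballyMinimal]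
    (hO6 : Summit.BirchSwinnertonDyer.Rank1Residual.Additive.ClassO6 W 3)
    (hev : Even (padicValInt 3 W.minimalDiscriminantInt))
    (hsq : W.minimalDiscriminantInt / 3 ^ padicValInt 3 W.minimalDiscriminantInt % 3 = 1)
    (𝓜 : W.NineGoodModel) (ρ : ONine →+* ZMod 3) :
    (3 : ℤ) ∣ 𝓜.specialFibreTrace ρ ∧ (𝓜.specialFibreTrace ρ).natAbs ≤ 3 := by
  rw [specialFibreTrace_eq_psUntwistedTrace_of_psRow W hO6 hev hsq 𝓜 ρ]
  exact ⟨PSUntwistedTrace.three_dvd_psUntwistedTrace W, PSUntwistedTrace.natAbs_psUntwistedTrace_le W⟩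

/-- And under the existence fact THE descended Frobenius matrix of a principal-series row has `tr M = a_w(W)`
computed from ANY good model and ANY reduction map (the `trace_eq` clause of the named fact read model-freely).
[cite: BerthelotOgus1983, Prop. (3.14)] [cite: Katz1981CrystallineDieudonne, (6.1.1)] -/
theorem trace_eq_psUntwistedTrace_of_psRow (hex : WeierstrassCurve.isDescendedFrobeniusMatrix_exists)
    (W : WeierstrassCurve ℚ) [W.IsElliptic] [W.IsGloballyMinimal]
    (hO6 : Summit.BirchSwinnertonDyer.Rank1Residual.Additive.ClassO6 W 3)
    (hev : Even (padicValInt 3 W.minimalDiscriminantInt))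
    (hsq : W.minimalDiscriminantInt / 3 ^ padicValInt 3 W.minimalDiscriminantInt % 3 = 1)
    {M : Matrix (Fin 2) (Fin 2) ℚ_[3]} (hM : W.IsDescendedFrobeniusMatrix M) :
    M.trace = ((W.psUntwistedTrace : ℤ) : ℚ_[3]) := by
  obtain ⟨𝓜⟩ := hM.nonempty_nineGoodModel
  obtain ⟨ρ⟩ := nonempty_residueMap
  rw [hM.trace_eq hex 𝓜 ρ (three_dvd_specialFibreTrace_of_psRow W hO6 hev hsq 𝓜 ρ).1,
    specialFibreTrace_eq_psUntwistedTrace_of_psRow W hO6 hev hsq 𝓜 ρ]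

end Summit.BirchSwinnertonDyer.BirchSwinnertonDyer.Theorems.NineIntegers

end
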